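import Summits.MatrixMultiplication.OmegaCensus.SmallFormats.MatMul227GF3EnumSymmetry
import Summits.MatrixMultiplication.OmegaCensus.SmallFormats.MatMul22nGF3MarginalCensus
import HarnessLib

/-!
# ω-census family (a): kernel `(henum)` at `(7,23)` — from count vectors to marginals

Cell `pub-omega` (unit `pub-omega-tensor`, gen 31), topic `Summits/MatrixMultiplication/OmegaCensus`
(sub-folder `SmallFormats`). Framing (verbatim): lottery ticket; floor = certified bounds/negative ranges.
HONEST FRAMING: bookkeeping — part 11 of 12 of the KERNEL proof of the ENUMERATION hypothesis `(henum)` of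
`twentyfour_le_tensorRank_227_gf3_of_enumeration` (`MatMul22nGF3MarginalCensus`) for the six-orbit list of the
`𝔽₃` `⟨2,2,7⟩@23` X-marginal census (desk-certified ×3 before: ENUM-X2 §6/§8). The EXCLUSION hypothesis `(hexcl)`
stays engine-side (Pa17: two code-disjoint exact engines; the IP instrument); nothing here is a bound on `ω`, and no
sentence here is 'R_𝔽₃(⟨2,2,7⟩) ≥ 24'.

GLUE to the census files: the class of a coefficient matrix (`classOf`, flat `2 × 2` matrices as in
`MatMul22nRankGF3LowerBound`), the count vector `cnt m` of a nowhere-zero marginal, `XCaps3 7 23 m ⇒ Adm (cnt m)`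
(each of the 82 table clauses identified with its `XCaps3` family by `decide`), equal count vectors ⇒ `InOrbit`
(a class-matching permutation via `Equiv.ofFiberEquiv`, and signs), words ⇒ orbit moves (`InOrbit.trans`); the three
representatives `REP j`; and the THEOREMS: `henum_227_gf3` (the enumeration hypothesis at `(7,23)` holds for
`Reps723 = {REP 0, REP 1, REP 2}`), `twentyfour_le_tensorRank_227_gf3_of_exclusion` and
`tensorRank_227_gf3_mem_of_exclusion` (`R_𝔽₃(⟨2,2,7⟩) ∈ [24, 25]` conditional ONLY on the exclusion of the three
explicit representatives — engine-side, Pa17).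
-/

namespace Summit.MatrixMultiplication.OmegaCensus.SmallFormats.Enum723

set_option maxRecDepth 4000

open Finset

/-! ## From count vectors to marginals: classes, counts, the clause semantics -/

open Summit.MatrixMultiplication.OmegaCensus.RankOnePlaneCapGeneral
open Literature.Computability.AlgebraicComplexity Matrix

/-- Flattened `2 × 2` matrices. -/
abbrev F4 := Fin 2 × Fin 2 → ZMod 3

/-- Entry 4-tuple ↦ flat matrix. -/
def ofT (t : ℕ × ℕ × ℕ × ℕ) : F4 := mk4 (t.1 : ZMod 3) (t.2.1 : ZMod 3) (t.2.2.1 : ZMod 3) (t.2.2.2 : ZMod 3)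

/-- Class `a` as a flat matrix (`0` beyond the table). -/
def clsF (a : ℕ) : F4 := ofT (clsT.getD a (0, 0, 0, 0))

/-- Class `a` as a matrix. -/
def clsM (a : ℕ) : Matrix (Fin 2) (Fin 2) (ZMod 3) := Matrix.of fun i j => clsF a (i, j)

/-- `A` is `±` class `a`. -/
def IsCls (A : F4) (a : ℕ) : Prop := A = clsF a ∨ A = -clsF a

/-- Entrywise equality test of flat matrices. -/
def eq4 (A B : F4) : Bool :=
  decide (A (0, 0) = B (0, 0) ∧ A (0, 1) = B (0, 1) ∧ A (1, 0) = B (1, 0) ∧ A (1, 1) = B (1, 1))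

/-- `eq4` tests equality. -/
theorem eq4_iff (A B : F4) : eq4 A B = true ↔ A = B := by
  rw [eq4, decide_eq_true_eq]
  constructor
  · rintro ⟨h1, h2, h3, h4⟩
    funext ⟨i, j⟩
    fin_cases i <;> fin_cases j
    · exact h1
    · exact h2
    · exact h3
    · exact h4
  · rintro rfl; exact ⟨rfl, rfl, rfl, rfl⟩

/-- Decidability by the Boolean test. -/
instance (A : F4) (a : ℕ) : Decidable (IsCls A a) :=
  decidable_of_iff (eq4 A (clsF a) = true ∨ eq4 A (-clsF a) = true) (by rw [eq4_iff, eq4_iff]; rfl)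

/-- The class of a flat matrix (`40` if zero). -/
def classOf (A : F4) : ℕ := ((List.range 40).find? fun a => decide (IsCls A a)).getD 40

/-- **Count vector of a marginal**: the number of terms whose coefficient matrix is `±` class `a`. -/
def cnt {r : ℕ} (m : Fin r → Matrix (Fin 2) (Fin 2) (ZMod 3)) (a : ℕ) : ℕ :=
  (Finset.univ.filter fun i => IsCls (mflat (m i)) a).card

/-- Left multiplication on flat matrices. -/
def mulF (P A : F4) : F4 := fun b => P (b.1, 0) * A (0, b.2) + P (b.1, 1) * A (1, b.2)

/-- Transpose on flat matrices. -/
def trF (A : F4) : F4 := fun b => A (b.2, b.1)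

/-- The generator matrices `A`, `A²`, `B`, `C` (flat). -/
def genF (s : ℕ) : F4 :=
  if s = 0 then mk4 1 1 0 1 else if s = 1 then mk4 1 2 0 1 else if s = 2 then mk4 1 0 0 2 else mk4 0 1 1 0

/-- The generator matrices as matrices. -/
def genM (s : ℕ) : Matrix (Fin 2) (Fin 2) (ZMod 3) := Matrix.of fun i j => genF s (i, j)

/-- The move of generator `s` on flat matrices: left multiplication (`s ≤ 3`) or transpose (`s = 4`). -/
def moveF (s : ℕ) (A : F4) : F4 := if s = 4 then trF A else mulF (genF s) A

/-- The move of generator `s` on matrices. -/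
def moveM (s : ℕ) (U : Matrix (Fin 2) (Fin 2) (ZMod 3)) : Matrix (Fin 2) (Fin 2) (ZMod 3) :=
  if s = 4 then Uᵀ else genM s * U

/-- The move of a word on a marginal (generators applied left to right). -/
def moveW {r : ℕ} : List ℕ → (Fin r → Matrix (Fin 2) (Fin 2) (ZMod 3)) → Fin r → Matrix (Fin 2) (Fin 2) (ZMod 3)
  | [], m => m
  | s :: w, m => moveW w fun i => moveM s (m i)

/-- The `Fin 32` index of J-clause `k`. -/
def jfin (k : ℕ) : Fin 32 := ⟨jIdxL.getD k 0 % 32, Nat.mod_lt _ (by norm_num)⟩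

/-- The `Fin 18` index of Q-clause `k`. -/
def qfin (k : ℕ) : Fin 18 := ⟨(k - 40) % 18, Nat.mod_lt _ (by norm_num)⟩

/-- The row/column vectors `λ` of clauses `32–39`. -/
def lamF (t : ℕ) : Fin 2 → ZMod 3 :=
  if t = 0 then ![1, 0] else if t = 1 then ![0, 1] else if t = 2 then ![1, 1] else ![1, 2]

/-- The invertible point of line clause `58 + t` (as a matrix). -/
def linM (t : ℕ) : Matrix (Fin 2) (Fin 2) (ZMod 3) := Matrix.of fun i j => ofT (linT.getD t (0, 0, 0, 0)) (i, j)

/-- **Semantics of clause `k`** on a flat coefficient matrix. -/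
def csem (k : ℕ) (A : F4) : Prop :=
  if k < 32 then perp3 A (jfin k) = true
  else if k < 36 then lamF (k - 32) 0 * A (0, 0) + lamF (k - 32) 1 * A (1, 0) = 0 ∧
    lamF (k - 32) 0 * A (0, 1) + lamF (k - 32) 1 * A (1, 1) = 0
  else if k < 40 then A (0, 0) * lamF (k - 36) 0 + A (0, 1) * lamF (k - 36) 1 = 0 ∧
    A (1, 0) * lamF (k - 36) 0 + A (1, 1) * lamF (k - 36) 1 = 0
  else if k < 58 then perpQ3 A (qfin k) = true
  else pdot3 A (linM (k - 58)) = 0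

/-- Decidability by the Boolean test. -/
instance (k : ℕ) (A : F4) : Decidable (csem k A) := by unfold csem; infer_instance

/-! ### Table facts (by `decide` over the 81 flat matrices) -/

/-- Every nonzero flat matrix is `±` exactly one class, its `classOf`. -/
theorem classOf_spec : ∀ A : F4, isZero43 A = false → classOf A < 40 ∧ IsCls A (classOf A) :=
  forall_of_forall_mk4 (by decide)

/-- `classOf` is the only class. -/
theorem classOf_unique : ∀ A : F4, ∀ a, a < 40 → IsCls A a → classOf A = a :=
  forall_of_forall_mk4 (by decide)

/-- Classes are nonzero. -/
theorem isCls_nonzero : ∀ A : F4, ∀ a, a < 40 → IsCls A a → isZero43 A = false :=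
  forall_of_forall_mk4 (by decide)

/-- The incidence table is the clause semantics on the classes. -/
theorem inc_eq_csem : ∀ a, a < 40 → ∀ k, k < 82 → inc a k = if csem k (clsF a) then 1 else 0 := by
  decide +kernel

/-- The clause semantics are sign-invariant. -/
theorem csem_neg : ∀ A : F4, ∀ k, k < 82 → (csem k (-A) ↔ csem k A) :=
  forall_of_forall_mk4 (by decide +kernel)

/-- The moves act on classes through the generator tables: `moveF s A` is `±` class `b` iff `A` is `±` class
`gsrc s b`. -/
theorem move_cls : ∀ A : F4, ∀ s, s < 5 → ∀ b, b < 40 → (IsCls (moveF s A) b ↔ IsCls A (gsrc s b)) :=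
  forall_of_forall_mk4 (by decide +kernel)

/-- The moves preserve nonzero-ness. -/
theorem move_nonzero : ∀ A : F4, ∀ s, s < 5 → isZero43 A = false → isZero43 (moveF s A) = false :=
  forall_of_forall_mk4 (by decide +kernel)

/-- The generator matrices are invertible. -/
theorem genM_det : ∀ s, s < 4 → (genM s).det ≠ 0 := by decide

/-- The line points are invertible. -/
theorem linM_det : ∀ t, t < 24 → (linM t).det ≠ 0 := by decide

/-- The row/column vectors are nonzero. -/
theorem lamF_ne : ∀ t, t < 4 → lamF t ≠ 0 := by decide

/-- Two matrices of the same class differ by a sign. -/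
theorem eq_or_eq_neg_of_isCls : ∀ A B : F4, ∀ a, a < 40 → IsCls A a → IsCls B a → B = A ∨ B = -A := by
  intro A B a ha h1 h2
  rcases h1 with rfl | rfl <;> rcases h2 with rfl | rfl <;> simp

/-! ### Flat/matrix plumbing -/

/-- A nonzero matrix is nonzero when flattened. -/
theorem isZero43_mflat {U : Matrix (Fin 2) (Fin 2) (ZMod 3)} (hU : U ≠ 0) : isZero43 (mflat U) = false := by
  rw [Bool.eq_false_iff]
  intro h
  have h' := of_decide_eq_true h
  apply hU
  ext i j
  fin_cases i <;> fin_cases j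
  · exact h'.1
  · exact h'.2.1
  · exact h'.2.2.1
  · exact h'.2.2.2

/-- `mflat` commutes with negation. -/
theorem mflat_neg (U : Matrix (Fin 2) (Fin 2) (ZMod 3)) : mflat (-U) = -mflat U := rfl

/-- `mflat` is injective. -/
theorem mflat_injective {U V : Matrix (Fin 2) (Fin 2) (ZMod 3)} (h : mflat U = mflat V) : U = V := by
  ext i j; exact congrFun h (i, j)

/-- The flat form of a class matrix is the class. -/
theorem mflat_clsM (a : ℕ) : mflat (clsM a) = clsF a := by
  funext ⟨i, j⟩; rfl

/-- `mflat` turns matrix products into `mulF`. -/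
theorem mflat_mul (P U : Matrix (Fin 2) (Fin 2) (ZMod 3)) : mflat (P * U) = mulF (mflat P) (mflat U) := by
  funext ⟨i, j⟩
  simp [mflat, mulF, Matrix.mul_apply, Fin.sum_univ_two]

/-- `mflat` turns transpose into `trF`. -/
theorem mflat_transpose (U : Matrix (Fin 2) (Fin 2) (ZMod 3)) : mflat Uᵀ = trF (mflat U) := rfl

/-- The flat form of a generator matrix. -/
theorem mflat_genM (s : ℕ) : mflat (genM s) = genF s := by funext ⟨i, j⟩; rfl

/-- `mflat` intertwines the matrix move and the flat move. -/
theorem mflat_moveM (s : ℕ) (U : Matrix (Fin 2) (Fin 2) (ZMod 3)) : mflat (moveM s U) = moveF s (mflat U) := by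
  by_cases h : s = 4
  · subst h; rfl
  · rw [moveM, moveF, if_neg h, if_neg h, mflat_mul, mflat_genM]

/-- Matrices of the same class are equal up to a unit scalar. -/
theorem exists_smul_of_isCls {U V : Matrix (Fin 2) (Fin 2) (ZMod 3)} {a : ℕ} (ha : a < 40)
    (hU : IsCls (mflat U) a) (hV : IsCls (mflat V) a) : ∃ c : ZMod 3, c ≠ 0 ∧ V = c • U := by
  rcases eq_or_eq_neg_of_isCls _ _ a ha hU hV with h | h
  · exact ⟨1, one_ne_zero, by rw [one_smul]; exact mflat_injective h⟩
  · refine ⟨-1, by decide, mflat_injective ?_⟩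
    rw [h]; funext b; simp [mflat]

/-! ### The count vector of a nowhere-zero marginal is admissible -/

section Counting

variable {r : ℕ} (m : Fin r → Matrix (Fin 2) (Fin 2) (ZMod 3)) (hm : ∀ i, m i ≠ 0)
include hm

/-- The class of each term is a class. -/
theorem classOf_lt (i : Fin r) : classOf (mflat (m i)) < 40 :=
  (classOf_spec _ (isZero43_mflat (hm i))).1

/-- The fiber of `classOf` over `a` is the set counted by `cnt`. -/
theorem filter_classOf_eq (a : ℕ) (ha : a < 40) :
    (Finset.univ.filter fun i => classOf (mflat (m i)) = a) = Finset.univ.filter fun i => IsCls (mflat (m i)) a := by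
  ext i
  simp only [Finset.mem_filter, Finset.mem_univ, true_and]
  constructor
  · intro h; rw [← h]; exact (classOf_spec _ (isZero43_mflat (hm i))).2
  · intro h; exact classOf_unique _ a ha h

/-- **Counting a sign-invariant clause class by class.** -/
theorem card_filter_csem (k : ℕ) (hk : k < 82) :
    (Finset.univ.filter fun i => csem k (mflat (m i))).card = load (cnt m) k := by
  classical
  rw [Finset.card_eq_sum_card_fiberwise (f := fun i => classOf (mflat (m i))) (t := Finset.range 40)
    (fun i _ => Finset.mem_range.mpr (classOf_lt m hm i))]
  refine Finset.sum_congr rfl fun a ha => ?_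
  have ha' := Finset.mem_range.mp ha
  rw [inc_eq_csem a ha' k hk]
  have key : ∀ i, classOf (mflat (m i)) = a → (csem k (mflat (m i)) ↔ csem k (clsF a)) := by
    intro i hi
    have hc : IsCls (mflat (m i)) a := by rw [← hi]; exact (classOf_spec _ (isZero43_mflat (hm i))).2
    rcases hc with h | h
    · rw [h]
    · rw [show mflat (m i) = -clsF a by rw [h], csem_neg _ k hk]
  split_ifs with hc
  · rw [mul_one, cnt, ← filter_classOf_eq m hm a ha', Finset.filter_filter]
    congr 1; ext i; simp only [Finset.mem_filter, Finset.mem_univ, true_and]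
    exact ⟨fun h => h.2, fun h => ⟨(key i h).mpr hc, h⟩⟩
  · rw [mul_zero, Finset.card_eq_zero, Finset.filter_filter]
    refine Finset.filter_eq_empty_iff.mpr fun i _ h => hc ((key i h.2).mp h.1)

/-- The total of the count vector is the number of terms. -/
theorem tot_cnt : tot (cnt m) = r := by
  classical
  have h := Finset.card_eq_sum_card_fiberwise (s := (Finset.univ : Finset (Fin r)))
    (f := fun i => classOf (mflat (m i))) (t := Finset.range 40)
    (fun i _ => Finset.mem_range.mpr (classOf_lt m hm i))
  rw [Finset.card_univ, Fintype.card_fin] at h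
  have e : tot (cnt m) = ∑ a ∈ Finset.range 40, (Finset.univ.filter fun i => classOf (mflat (m i)) = a).card :=
    Finset.sum_congr rfl fun a ha => by rw [filter_classOf_eq m hm a (Finset.mem_range.mp ha), cnt]
  rw [e, ← h]

end Counting

/-- Row clause semantics = `vecMul λ U = 0`. -/
theorem vecMul_eq_zero_iff (lam : Fin 2 → ZMod 3) (U : Matrix (Fin 2) (Fin 2) (ZMod 3)) :
    Matrix.vecMul lam U = 0 ↔ lam 0 * U 0 0 + lam 1 * U 1 0 = 0 ∧ lam 0 * U 0 1 + lam 1 * U 1 1 = 0 := by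
  rw [funext_iff]
  simp [Matrix.vecMul, dotProduct, Fin.sum_univ_two, Fin.forall_fin_two]

/-- Column clause semantics = `mulVec U λ = 0`. -/
theorem mulVec_eq_zero_iff (lam : Fin 2 → ZMod 3) (U : Matrix (Fin 2) (Fin 2) (ZMod 3)) :
    Matrix.mulVec U lam = 0 ↔ U 0 0 * lam 0 + U 0 1 * lam 1 = 0 ∧ U 1 0 * lam 0 + U 1 1 * lam 1 = 0 := by
  rw [funext_iff]
  simp [Matrix.mulVec, dotProduct, Fin.sum_univ_two, Fin.forall_fin_two]

/-- **The count vector of a nowhere-zero marginal in the universe `XCaps3 7 23` is admissible.** -/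
theorem adm_cnt (m : Fin 23 → Matrix (Fin 2) (Fin 2) (ZMod 3)) (hm : ∀ i, m i ≠ 0) (hX : XCaps3 7 23 m) :
    Adm (cnt m) := by
  classical
  obtain ⟨hpt, hli, -, hJ, hQ, hR, hC, -⟩ := hX
  refine ⟨fun k hk => ?_, fun a ha => ?_, tot_cnt m hm⟩
  · rw [← card_filter_csem m hm k hk]
    -- identify the clause with the corresponding `XCaps3` family
    by_cases h1 : k < 32
    · have hc : cap k = 2 := cap_J k h1
      rw [hc]
      have := hJ (jfin k)
      have e : (Finset.univ.filter fun i => csem k (mflat (m i))) =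
          Finset.univ.filter fun i => perp3 (mflat (m i)) (jfin k) = true := by
        congr 1; ext i; simp [csem, h1]
      rw [e]; omega
    by_cases h2 : k < 36
    · have hc : cap k = 4 := by interval_cases k <;> rfl
      rw [hc]
      have hl := (hR (lamF (k - 32)) (lamF_ne _ (by omega))).1
      have e : (Finset.univ.filter fun i => csem k (mflat (m i))) =
          Finset.univ.filter fun i => Matrix.vecMul (lamF (k - 32)) (m i) = 0 := by
        congr 1; ext i; simp only [csem, if_neg h1, if_pos h2, vecMul_eq_zero_iff, mflat_apply]
      rw [e]; omega
    by_cases h3 : k < 40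
    · have hc : cap k = 4 := by interval_cases k <;> rfl
      rw [hc]
      have hl := (hC (lamF (k - 36)) (lamF_ne _ (by omega))).1
      have e : (Finset.univ.filter fun i => csem k (mflat (m i))) =
          Finset.univ.filter fun i => Matrix.mulVec (m i) (lamF (k - 36)) = 0 := by
        congr 1; ext i; simp only [csem, if_neg h1, if_neg h2, if_pos h3, mulVec_eq_zero_iff, mflat_apply]
      rw [e]; omega
    by_cases h4 : k < 58
    · have hc : cap k = 2 := by interval_cases k <;> rfl
      rw [hc]
      have := hQ (qfin k)
      have e : (Finset.univ.filter fun i => csem k (mflat (m i))) =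
          Finset.univ.filter fun i => perpQ3 (mflat (m i)) (qfin k) = true := by
        congr 1; ext i; simp [csem, h1, h2, h3, h4]
      rw [e]; omega
    · have hc : cap k = 9 := by interval_cases k <;> rfl
      rw [hc]
      have := hli (linM (k - 58)) (linM_det _ (by omega))
      have e : (Finset.univ.filter fun i => csem k (mflat (m i))) =
          Finset.univ.filter fun i => dotX (mflat (m i)) (linM (k - 58)) = 0 := by
        congr 1; ext i; simp [csem, h1, h2, h3, h4, dotX_eq_pdot3]
      rw [e]; omega
  · -- point cap at `clsM a`
    have hne : clsM a ≠ 0 := fun h => by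
      have h1 := isCls_nonzero (clsF a) a ha (Or.inl rfl)
      rw [← mflat_clsM, h] at h1
      exact absurd h1 (by decide)
    have h := hpt (clsM a) hne
    have hsub : (Finset.univ.filter fun i => IsCls (mflat (m i)) a) ⊆
        Finset.univ.filter fun i => ∃ c : ZMod 3, m i = c • clsM a := by
      intro i hi
      rw [Finset.mem_filter] at hi ⊢
      refine ⟨hi.1, ?_⟩
      rcases hi.2 with h' | h'
      · exact ⟨1, by rw [one_smul]; exact mflat_injective (by rw [h', mflat_clsM])⟩
      · exact ⟨-1, mflat_injective (by rw [h']; funext b; simp [mflat, clsM])⟩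
    have hle := Finset.card_le_card hsub
    rw [cnt]; omega

end Summit.MatrixMultiplication.OmegaCensus.SmallFormats.Enum723
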